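import Mathlib

/-!
# Normalising the exponents of a Kummer-type purely inseparable generator

Let `O` be a domain with fraction field `K` of characteristic `p`, `L ⊇ K` a field, and
`y ∈ L ∖ K` with `y ^ p = ∏ᵢ tᵢ ^ aᵢ`, `tᵢ ∈ O ∖ {0}`, `p ∤ aᵢ`.  Twisting the generator,
`y ↦ y' = y ^ c / ∏ᵢ tᵢ ^ qᵢ` with `c a₀ ≡ 1 [MOD p]` and `c aᵢ = p qᵢ + a'ᵢ`, `a'ᵢ = (c aᵢ) mod p`,
one obtains a generator `y' ∉ K` of the same shape whose exponent vector `a'` starts with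
`a'₀ = 1` and lies in `[1, p - 1]`.
-/

set_option linter.dupNamespace false

namespace Summit.ResolutionOfSingularities.ResolutionOfSingularities.Theorems.RadicialJung.CleanModelsSuffice

/-- **Normalisation of exponents.** Given `y ∉ K` with `y ^ p = ∏ᵢ tᵢ ^ aᵢ` (`tᵢ ≠ 0`, `p ∤ aᵢ`,
`p` prime), there are `c` prime to `p`, exponents `a'ᵢ ∈ [1, p - 1]` with `a'₀ = 1` and
`a'ᵢ ≡ c aᵢ [MOD p]`, and `y' ∉ K` with `y' ^ p = ∏ᵢ tᵢ ^ a'ᵢ`; explicitly `c` is an inverse of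
`a₀` modulo `p`, `a'ᵢ = (c aᵢ) mod p` and `y' = y ^ c / ∏ᵢ tᵢ ^ ((c aᵢ) / p)`. -/
theorem stub_normalizeExponents {O K L : Type} [CommRing O] [IsDomain O] [Field K] [Algebra O K]
    [IsFractionRing O K] [Field L] [Algebra K L] [Algebra O L] [IsScalarTower O K L]
    (p : ℕ) (hp : p.Prime) [CharP K p] (hdeg : Module.finrank K L = p) (m : ℕ)
    (t : Fin (m + 1) → O) (ht : ∀ i, t i ≠ 0) (a : Fin (m + 1) → ℕ) (ha : ∀ i, ¬ p ∣ a i)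
    (y : L) (hy : y ∉ Set.range (algebraMap K L))
    (hyp : y ^ p = algebraMap O L (∏ i, t i ^ a i)) :
    ∃ (y' : L) (a' : Fin (m + 1) → ℕ) (c : ℕ), y' ∉ Set.range (algebraMap K L) ∧
      a' 0 = 1 ∧ (∀ i, 1 ≤ a' i ∧ a' i < p) ∧ ¬ p ∣ c ∧ (∀ i, a' i ≡ c * a i [MOD p]) ∧
      y' ^ p = algebraMap O L (∏ i, t i ^ a' i) := by
  have _h := hdeg
  have hp1 : 1 < p := hp.one_lt
  -- injectivity of `O → L` and nonvanishing of the monomials `∏ tᵢ ^ eᵢ` in `L`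
  have hinj : Function.Injective (algebraMap O L) := by
    rw [IsScalarTower.algebraMap_eq O K L]
    exact (algebraMap K L).injective.comp (IsFractionRing.injective O K)
  have hne : ∀ e : Fin (m + 1) → ℕ, algebraMap O L (∏ i, t i ^ e i) ≠ 0 := fun e =>
    (map_ne_zero_iff _ hinj).mpr (Finset.prod_ne_zero_iff.mpr fun i _ => pow_ne_zero _ (ht i))
  have hy0 : y ≠ 0 := by
    rintro rfl
    exact hy ⟨0, map_zero _⟩
  -- `y ^ n ∉ K` whenever `p ∤ n`
  have hpow : ∀ n, ¬ p ∣ n → y ^ n ∉ Set.range (algebraMap K L) := by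
    rintro n hn ⟨k, hk⟩
    obtain ⟨u, -, hu⟩ := Nat.exists_mul_mod_eq_one_of_coprime
      ((Nat.Prime.coprime_iff_not_dvd hp).mpr hn).symm hp1
    obtain ⟨w, hw⟩ : ∃ w, n * u = p * w + 1 :=
      ⟨n * u / p, by have := Nat.div_add_mod (n * u) p; omega⟩
    refine hy ⟨k ^ u / (algebraMap O K (∏ i, t i ^ a i)) ^ w, ?_⟩
    rw [map_div₀, map_pow, map_pow, hk, ← IsScalarTower.algebraMap_apply, ← hyp, ← pow_mul y n u,
      hw, pow_succ, pow_mul, mul_div_cancel_left₀ _ (pow_ne_zero _ (pow_ne_zero _ hy0))]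
  -- the inverse `c` of `a 0` modulo `p`
  obtain ⟨c, -, hc⟩ := Nat.exists_mul_mod_eq_one_of_coprime
    ((Nat.Prime.coprime_iff_not_dvd hp).mpr (ha 0)).symm hp1
  have hpc : ¬ p ∣ c := by
    intro h
    have : a 0 * c % p = 0 := Nat.mod_eq_zero_of_dvd (dvd_mul_of_dvd_right h _)
    omega
  -- the key monomial identity in `O`
  have key : (∏ i, t i ^ a i) ^ c =
      (∏ i, t i ^ (c * a i % p)) * (∏ i, t i ^ (c * a i / p)) ^ p := by
    rw [← Finset.prod_pow, ← Finset.prod_pow, ← Finset.prod_mul_distrib]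
    refine Finset.prod_congr rfl fun i _ => ?_
    rw [← pow_mul, ← pow_mul, ← pow_add, Nat.mod_add_div', mul_comm (a i) c]
  refine ⟨y ^ c / algebraMap O L (∏ i, t i ^ (c * a i / p)), fun i => c * a i % p, c,
    ?_, ?_, fun i => ⟨Nat.pos_of_ne_zero fun h => ?_, Nat.mod_lt _ hp.pos⟩, hpc,
    fun i => Nat.mod_modEq _ _, ?_⟩
  · -- `y' ∉ K`
    rintro ⟨k, hk⟩
    refine hpow c hpc ⟨k * algebraMap O K (∏ i, t i ^ (c * a i / p)), ?_⟩
    rw [map_mul, ← IsScalarTower.algebraMap_apply, hk, div_mul_cancel₀ _ (hne _)]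
  · -- `a' 0 = 1`
    show c * a 0 % p = 1
    rwa [mul_comm]
  · -- `1 ≤ a' i`
    rcases (Nat.Prime.dvd_mul hp).mp (Nat.dvd_of_mod_eq_zero h) with h' | h'
    · exact hpc h'
    · exact ha i h'
  · -- `y' ^ p = ∏ tᵢ ^ a'ᵢ`
    show _ = algebraMap O L (∏ i, t i ^ (c * a i % p))
    rw [div_pow, div_eq_iff (pow_ne_zero _ (hne _)), ← pow_mul, mul_comm c p, pow_mul, hyp,
      ← map_pow, ← map_pow, ← map_mul, key]

end Summit.ResolutionOfSingularities.ResolutionOfSingularities.Theorems.RadicialJung.CleanModelsSuffice
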